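import Summits.CriticalPhenomena.PercolationContinuityZ3.Theorems.PercNearOneGluingNoHeavyLowerTailThreePointLBSwitchingClusters
import HarnessLib

/-!
# `NoHeavyLowerTail` (stmt-CriticalPhenomena-4575) — HYBRID / GROUP three-point lower bound by four switchings, I:
# unions of clusters ("group clusters"), their sealed-island facts F1′/F2′/F4′, and group connection

Support file (prover prim-cert-2 gen 9; `--supports stmt-CriticalPhenomena-4575`).  No named facts, no sorries.  Two small
definitions (`gcl`, `gconn`), bookkeeping for the formalisation of prim-ineq-gen-8's THEOREM (HYBRID/GROUP 3PT-LB,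
THEOREM-HYBRID-3PTLB.md, 2026-08-19): `E₃({P₁≁c}, {c≁P₃}, {P₁≁P₃′}) ≥ 0` for a vertex `c` and vertex sets `P₁`, `P₃ ⊆ P₃′`, on every
finite weighted graph — lit-2's four-switching proof of 3PT-LB (tree: `…ThreePointLBSwitching*`, `ThreePointLB.sahiE3_pairSep_nonneg`)
with the explored clusters replaced by UNIONS of clusters.

Vocabulary (tree): configurations `K : Finset (Sym2 V)`, `cl K x` [GladkovZimin2024 §4], `touch W`, `splice F K₁ K₂` (`K₁` on `F`, `K₂`
off `F`).  Here:
* `gcl K S = ⋃_{v ∈ S} cl K v` — the GROUP CLUSTER of a vertex set `S` (a union of `K`-clusters); `gcl_eq_of_agree`,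
  `selfDetermined_touch_gcl` (the exploration `K ↦ touch (gcl K S)` is self-determined [Gladkov2024, Def. 2.4 / Lemma 3.1]),
  `touch_gsdiff_congr` (the second region of a two-group exploration is determined on the union);
* the sealed-island facts for `W = gcl X S` (THEOREM-HYBRID-3PTLB F1′/F2′/F4′; single-cluster versions in `…ThreePointLBSwitchingClusters`):
  `cl_splice_touch_gcl` (F1′: in `X on touch W | ω` the cluster of every `w ∈ W` is `cl X w`), `mem_cl_splice_touch_gcl_iff_of_not_mem`
  (F2′: from `u ∉ W` one moves by `ω`-pairs not meeting `W`), `mem_cl_splice_touch_gcl_iff` (case-free form),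
  `cl_subset_cl_splice_sdiff_of_subset` (F4′(i): an `X`-cluster inside `W′` and disjoint from `W` stays connected in
  `X on touch W′ ∖ touch W | ω`); F4′(ii) is the tree's `ThreePointLB.cl_sdiff_touch_subset_cl_splice`;
* `gconn S T` — the event "some vertex of `S` is joined to some vertex of `T`" (group connection), with `mem_gconn_comm`, monotonicity,
  `mem_gcl_iff_mem_gconn`, `mem_gconn_trans_vertex` (transitivity through a single vertex), and the three REWRITING rules in an explored
  output `X on touch (gcl X S) | ω`: `splice_mem_gconn_root` / `splice_mem_gconn_target` (one side is the explored group: read it in `X`),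
  `splice_mem_gconn_vertex` (a single vertex `c` against any group: `c ∈ W` and read in `X`, or `c ∉ W` and read in `ω ∖ touch W`).
-/

noncomputable section

namespace Summit.CriticalPhenomena.PercolationContinuityZ3.Theorems

namespace HybridThreePointLB

open Finset Literature.Probability.Percolation Literature.Probability.Percolation.DecisionTree
open Literature.Probability.Percolation.Gladkov ThreePointLB
open scoped Classical

variable {V : Type*} [Fintype V] [DecidableEq V]

/-! ### Group clusters -/

/-- The group cluster of a vertex set: `gcl K S = ⋃_{v ∈ S} cl K v`. [this work] -/
def gcl (K : Finset (Sym2 V)) (S : Finset V) : Finset V := S.biUnion fun v => cl K v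

/-- Membership in a group cluster. [this work] -/
theorem mem_gcl {K : Finset (Sym2 V)} {S : Finset V} {u : V} : u ∈ gcl K S ↔ ∃ v ∈ S, u ∈ cl K v := by
  unfold gcl; rw [Finset.mem_biUnion]

/-- Each member's cluster lies in the group cluster. [this work] -/
theorem cl_subset_gcl {K : Finset (Sym2 V)} {S : Finset V} {v : V} (hv : v ∈ S) : cl K v ⊆ gcl K S :=
  fun _ hu => mem_gcl.2 ⟨v, hv, hu⟩

/-- Members lie in the group cluster. [this work] -/
theorem mem_gcl_of_mem {K : Finset (Sym2 V)} {S : Finset V} {v : V} (hv : v ∈ S) : v ∈ gcl K S :=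
  cl_subset_gcl hv (mem_cl_self K v)

/-- The cluster of any vertex of the group cluster lies in it. [this work] -/
theorem cl_subset_gcl_of_mem {K : Finset (Sym2 V)} {S : Finset V} {w : V} (hw : w ∈ gcl K S) : cl K w ⊆ gcl K S := by
  obtain ⟨v, hv, hwv⟩ := mem_gcl.1 hw
  rw [cl_eq_cl_of_mem hwv]
  exact cl_subset_gcl hv

omit [DecidableEq V] in
/-- A group cluster is closed under `K`-open pairs. [this work] -/
theorem mem_gcl_of_adj [DecidableEq V] {K : Finset (Sym2 V)} {S : Finset V} {y y' : V} (hy : y ∈ gcl K S)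
    (h : (openGraph (↑K : Set (Sym2 V))).Adj y y') : y' ∈ gcl K S := by
  obtain ⟨v, hv, hyv⟩ := mem_gcl.1 hy
  exact mem_gcl.2 ⟨v, hv, mem_cl_of_adj hyv h⟩

/-- **A group cluster is determined by the pairs meeting it.** [cite: GladkovZimin2024, §4 (Example 4.4), union form] -/
theorem gcl_eq_of_agree {K K' : Finset (Sym2 V)} {S : Finset V} (h : ∀ e ∈ touch (gcl K S), (e ∈ K ↔ e ∈ K')) :
    gcl K' S = gcl K S := by
  unfold gcl
  refine Finset.biUnion_congr rfl fun v hv => ?_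
  exact cl_eq_of_agree fun e he => h e (touch_mono (cl_subset_gcl hv) he)

/-- **The exploration of a group, `K ↦ touch (gcl K S)`, is self-determined.** [cite: Gladkov2024, Def. 2.4 and Lemma 3.1] -/
theorem selfDetermined_touch_gcl (S : Finset V) : SelfDetermined fun K : Finset (Sym2 V) => touch (gcl K S) :=
  fun K K' h => by simp only at h ⊢; rw [gcl_eq_of_agree h]

/-- The second region of a two-group exploration is determined on the union of the two regions. [this work] -/
theorem touch_gsdiff_congr (S T : Finset V) (K K' : Finset (Sym2 V))
    (h : ∀ i ∈ touch (gcl K S) ∪ (touch (gcl K T) \ touch (gcl K S)), (i ∈ K ↔ i ∈ K')) :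
    touch (gcl K' T) \ touch (gcl K' S) = touch (gcl K T) \ touch (gcl K S) := by
  have hS : gcl K' S = gcl K S := gcl_eq_of_agree fun e he => h e (Finset.mem_union_left _ he)
  have hT : gcl K' T = gcl K T := by
    refine gcl_eq_of_agree fun e he => h e ?_
    by_cases he' : e ∈ touch (gcl K S)
    · exact Finset.mem_union_left _ he'
    · exact Finset.mem_union_right _ (Finset.mem_sdiff.2 ⟨he, he'⟩)
  rw [hS, hT]

/-! ### F1′: a union of clusters sealed by its boundary -/

/-- **(F1′)** In `X on touch (gcl X S) | ω` the cluster of every `w ∈ gcl X S` is `cl X w`. [this work] -/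
theorem cl_splice_touch_gcl {X : Finset (Sym2 V)} {S : Finset V} {w : V} (hw : w ∈ gcl X S) (ω : Finset (Sym2 V)) :
    cl (splice (touch (gcl X S)) X ω) w = cl X w :=
  cl_eq_of_agree_of_subset (touch_mono (cl_subset_gcl_of_mem hw)) fun _ he => (mem_splice_of_mem he).symm

/-! ### F2′: outside the sealed union one moves by `ω`-pairs avoiding it -/

/-- A pair open in `X on touch W | ω` (`W = gcl X S`) with one endpoint off `W` has both endpoints off `W`. [this work] -/
theorem not_mem_of_adj_splice_touch_gcl {X ω : Finset (Sym2 V)} {S : Finset V} {y y' : V} (hy : y ∉ gcl X S)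
    (h : (openGraph (↑(splice (touch (gcl X S)) X ω) : Set (Sym2 V))).Adj y y') : y' ∉ gcl X S := by
  intro hy'
  rw [adj_iff] at h
  have heX : s(y, y') ∈ X := (mem_splice_of_mem (mk_mem_touch.2 (Or.inr hy'))).1 h.1
  exact hy (mem_gcl_of_adj hy' (adj_iff.2 ⟨by rw [Sym2.eq_swap]; exact heX, h.2.symm⟩))

/-- **(F2′)** For `u ∉ W = gcl X S`: in `X on touch W | ω`, `u'` is joined to `u` iff it is joined to `u` by `ω`-open pairs not
meeting `W`. [this work] -/
theorem mem_cl_splice_touch_gcl_iff_of_not_mem {X ω : Finset (Sym2 V)} {S : Finset V} {u : V} (hu : u ∉ gcl X S) (u' : V) :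
    u' ∈ cl (splice (touch (gcl X S)) X ω) u ↔ u' ∈ cl (ω \ touch (gcl X S)) u := by
  constructor
  · intro h
    obtain ⟨w⟩ := mem_cl.1 h
    refine mem_cl.2 (reachable_of_walk (C := Finset.univ.filter fun y => y ∉ gcl X S) ?_ ?_ w
      (Finset.mem_filter.2 ⟨Finset.mem_univ _, hu⟩))
    · intro y y' hy hyy'
      exact Finset.mem_filter.2 ⟨Finset.mem_univ _, not_mem_of_adj_splice_touch_gcl (Finset.mem_filter.1 hy).2 hyy'⟩
    · intro y y' hy hyy'
      have hyW := (Finset.mem_filter.1 hy).2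
      have hy'W := not_mem_of_adj_splice_touch_gcl hyW hyy'
      rw [adj_iff] at hyy' ⊢
      have he : s(y, y') ∉ touch (gcl X S) := by rw [mk_mem_touch, not_or]; exact ⟨hyW, hy'W⟩
      exact ⟨Finset.mem_sdiff.2 ⟨(mem_splice_of_not_mem he).1 hyy'.1, he⟩, hyy'.2⟩
  · intro h
    exact cl_mono (sdiff_subset_splice subset_rfl) u h

/-- **(F1′ + F2′, case-free form)** in `X on touch W | ω` (`W = gcl X S`), `u ~ u'` iff either `u ∈ W` and `u' ∈ cl X u`, or `u ∉ W`
and `u'` is reached from `u` by `ω`-pairs not meeting `W`. [this work] -/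
theorem mem_cl_splice_touch_gcl_iff (X ω : Finset (Sym2 V)) (S : Finset V) (u u' : V) :
    u' ∈ cl (splice (touch (gcl X S)) X ω) u ↔
      (u ∈ gcl X S ∧ u' ∈ cl X u) ∨ (u ∉ gcl X S ∧ u' ∈ cl (ω \ touch (gcl X S)) u) := by
  by_cases hu : u ∈ gcl X S
  · rw [cl_splice_touch_gcl hu]; simp [hu]
  · rw [mem_cl_splice_touch_gcl_iff_of_not_mem hu]; simp [hu]

/-! ### F4′(i): a cluster inside `W′` and off `W` stays connected when `touch W′ ∖ touch W` carries `X` -/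

/-- **(F4′(i))** If `cl X u ⊆ W'` and `cl X u` does not meet `W`, then `cl X u` is connected in `X on touch W' ∖ touch W | ω`: its
internal `X`-open pairs meet `W'` and not `W`. [this work] -/
theorem cl_subset_cl_splice_sdiff_of_subset {X : Finset (Sym2 V)} {W W' : Finset V} {u : V} (hsub : cl X u ⊆ W')
    (hdisj : ∀ y ∈ cl X u, y ∉ W) (ω : Finset (Sym2 V)) : cl X u ⊆ cl (splice (touch W' \ touch W) X ω) u := by
  intro u' hu'
  obtain ⟨w⟩ := mem_cl.1 hu'
  refine mem_cl.2 (reachable_of_walk (C := cl X u) (fun y y' hy hyy' => mem_cl_of_adj hy hyy') ?_ w (mem_cl_self X u))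
  intro y y' hy hyy'
  have hy' : y' ∈ cl X u := mem_cl_of_adj hy hyy'
  rw [adj_iff] at hyy' ⊢
  have he : s(y, y') ∈ touch W' \ touch W :=
    Finset.mem_sdiff.2 ⟨mk_mem_touch.2 (Or.inl (hsub hy)), by rw [mk_mem_touch, not_or]; exact ⟨hdisj y hy, hdisj y' hy'⟩⟩
  exact ⟨(mem_splice_of_mem he).2 hyy'.1, hyy'.2⟩

/-! ### Group connection events -/

/-- `gconn S T`: the event that some vertex of `S` is joined to some vertex of `T`. [this work] -/
def gconn (S T : Finset V) : Set (Finset (Sym2 V)) := {K | ∃ s ∈ S, ∃ t ∈ T, t ∈ cl K s}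

omit [DecidableEq V] in
/-- Membership in `gconn`. [this work] -/
theorem mem_gconn {K : Finset (Sym2 V)} {S T : Finset V} : K ∈ gconn S T ↔ ∃ s ∈ S, ∃ t ∈ T, t ∈ cl K s := Iff.rfl

omit [DecidableEq V] in
/-- Group connection is symmetric. [this work] -/
theorem mem_gconn_comm {K : Finset (Sym2 V)} {S T : Finset V} : K ∈ gconn S T ↔ K ∈ gconn T S := by
  constructor
  · rintro ⟨s, hs, t, ht, h⟩; exact ⟨t, ht, s, hs, mem_cl_comm.1 h⟩
  · rintro ⟨t, ht, s, hs, h⟩; exact ⟨s, hs, t, ht, mem_cl_comm.1 h⟩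

omit [DecidableEq V] in
/-- Group connection is monotone in the target group. [this work] -/
theorem mem_gconn_mono_right {K : Finset (Sym2 V)} {S T T' : Finset V} (hT : T ⊆ T') (h : K ∈ gconn S T) :
    K ∈ gconn S T' := by
  obtain ⟨s, hs, t, ht, hst⟩ := h
  exact ⟨s, hs, t, hT ht, hst⟩

omit [DecidableEq V] in
/-- Group connection is monotone in the configuration. [this work] -/
theorem mem_gconn_mono_cfg {K L : Finset (Sym2 V)} {S T : Finset V} (hKL : K ⊆ L) (h : K ∈ gconn S T) : L ∈ gconn S T := by
  obtain ⟨s, hs, t, ht, hst⟩ := h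
  exact ⟨s, hs, t, ht, cl_mono hKL s hst⟩

/-- A vertex lies in the group cluster iff it is group-connected to the group. [this work] -/
theorem mem_gcl_iff_mem_gconn {K : Finset (Sym2 V)} {S : Finset V} {c : V} : c ∈ gcl K S ↔ K ∈ gconn {c} S := by
  rw [mem_gcl]
  constructor
  · rintro ⟨v, hv, hcv⟩; exact ⟨c, Finset.mem_singleton_self c, v, hv, mem_cl_comm.1 hcv⟩
  · rintro ⟨s, hs, t, ht, h⟩
    rw [Finset.mem_singleton] at hs
    subst hs
    exact ⟨t, ht, mem_cl_comm.1 h⟩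

omit [DecidableEq V] in
/-- **Transitivity through a single vertex**: `c ~ S` and `c ~ T` give `T ~ S`. [this work] -/
theorem mem_gconn_trans_vertex {K : Finset (Sym2 V)} {S T : Finset V} {c : V} (hS : K ∈ gconn {c} S) (hT : K ∈ gconn {c} T) :
    K ∈ gconn T S := by
  obtain ⟨c₁, hc₁, s, hs, hsc⟩ := hS
  obtain ⟨c₂, hc₂, t, ht, htc⟩ := hT
  rw [Finset.mem_singleton] at hc₁ hc₂
  subst hc₁; subst hc₂
  exact ⟨t, ht, s, hs, mem_cl_trans (mem_cl_comm.1 htc) hsc⟩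

/-! ### Reading group connections in an explored output `X on touch (gcl X S) | ω` -/

/-- Roots in the explored group are read in `X`. [this work] -/
theorem splice_mem_gconn_root (X ω : Finset (Sym2 V)) (S T : Finset V) :
    splice (touch (gcl X S)) X ω ∈ gconn S T ↔ X ∈ gconn S T := by
  constructor
  · rintro ⟨s, hs, t, ht, h⟩
    rw [cl_splice_touch_gcl (mem_gcl_of_mem hs)] at h
    exact ⟨s, hs, t, ht, h⟩
  · rintro ⟨s, hs, t, ht, h⟩
    refine ⟨s, hs, t, ht, ?_⟩
    rw [cl_splice_touch_gcl (mem_gcl_of_mem hs)]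
    exact h

/-- Targets in the explored group are read in `X`. [this work] -/
theorem splice_mem_gconn_target (X ω : Finset (Sym2 V)) (S T : Finset V) :
    splice (touch (gcl X S)) X ω ∈ gconn T S ↔ X ∈ gconn T S := by
  rw [mem_gconn_comm, splice_mem_gconn_root, mem_gconn_comm]

/-- A single vertex `c` against any group `T` in the explored output: if `c` lies in the explored union it is read in `X`,
otherwise in `ω`-pairs avoiding the union. [this work] -/
theorem splice_mem_gconn_vertex (X ω : Finset (Sym2 V)) (S T : Finset V) (c : V) :
    splice (touch (gcl X S)) X ω ∈ gconn {c} T ↔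
      (X ∈ gconn {c} S ∧ X ∈ gconn {c} T) ∨ (X ∉ gconn {c} S ∧ ω \ touch (gcl X S) ∈ gconn {c} T) := by
  have hc : X ∈ gconn {c} S ↔ c ∈ gcl X S := mem_gcl_iff_mem_gconn.symm
  rw [hc]
  constructor
  · rintro ⟨c', hc', t, ht, h⟩
    rw [Finset.mem_singleton] at hc'
    subst hc'
    rcases (mem_cl_splice_touch_gcl_iff X ω S c' t).1 h with ⟨hcW, h'⟩ | ⟨hcW, h'⟩
    · exact Or.inl ⟨hcW, c', Finset.mem_singleton_self _, t, ht, h'⟩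
    · exact Or.inr ⟨hcW, c', Finset.mem_singleton_self _, t, ht, h'⟩
  · rintro (⟨hcW, c', hc', t, ht, h'⟩ | ⟨hcW, c', hc', t, ht, h'⟩)
    · rw [Finset.mem_singleton] at hc'; subst hc'
      exact ⟨c', Finset.mem_singleton_self _, t, ht, (mem_cl_splice_touch_gcl_iff X ω S c' t).2 (Or.inl ⟨hcW, h'⟩)⟩
    · rw [Finset.mem_singleton] at hc'; subst hc'
      exact ⟨c', Finset.mem_singleton_self _, t, ht, (mem_cl_splice_touch_gcl_iff X ω S c' t).2 (Or.inr ⟨hcW, h'⟩)⟩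

end HybridThreePointLB

end Summit.CriticalPhenomena.PercolationContinuityZ3.Theorems

end
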